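import Mathlib
import Summits.CriticalPhenomena.PercolationContinuityZ3.Theorems.PercNearOneGluingNoHeavyLowerTailSahiCombTriWCertGen

/-!
# The q-zeta certificate conjecture `CertGenKernel` is FALSE (the same `#β + #γ = 6` configuration, single-cube form; computational)

`FiveUpSet.CertGenKernel` (prim-masterthm-p5 gen 18, `…SahiCombTriWCertGen`) asserts that for all up-sets `X, Y` of a finite cube and every translate `t` SOME `q : ℚ`
makes the kernel of the certificate CERT-GEN(q) trivial (`CertGenKernelAt X Y t q`).  On a CYLINDER configuration (`X` constant along the coordinates of `t`) CERT-GEN(q)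
is exactly the tilt certificate `T(q)` of `…SahiCombTriWTiltCert` in single-cube language, so the gen-20 witness against `TiltCertIndep` (`…SahiCombTriWTiltCertFalse`) refutes
it too.  This file decides that witness directly in the single cube `Finset (Fin 6)` (coordinates `0,1` = the index block, `2,…,5` = the fibre block; a set is read as the
number `Σ_{j∈s} 2^j`):

* `X = cgX` = mask `0xfffffffffff0ff00` (the cylinder over `P = 0xffec`), `Y = cgY` = mask `0xf8f8e0e088880000`, `t = {0,1}`;
* `a = cgA q`, `b = cgB q`, `c = cgC q`: the polynomial kernel vector of `…TriWTiltCertFalse` (`ycoef`, tags `0/1/2`) transported to sets `d ↦ (tag, d ∩ {0,1}, d \ {0,1})`;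
  `c {3} = 1` for every `q`.
The three equation families of `CertGenKernelAt` hold for EVERY `q` (coefficientwise: `[d ⊆ u]` and `qzeta q d u` are monomials in `q`, the rational coefficient identities are
one `native_decide` each), the supports are right (`decide`), hence no `q` has a trivial kernel: **`not_certGenKernel : ¬ CertGenKernel`**.
So the reduction `triWIneq_of_certGenKernel` (`…TriWCertChain`) has a false premise; `TriWIneq` itself is NOT refuted (the Hall condition holds on this configuration).
HONEST LABEL: refutation of a conjecture of this theory by an explicit finite witness; three `native_decide` identities (proposed `--computational`), the rest kernel-checked.
[this work]
-/

namespace Summit.CriticalPhenomena.PercolationContinuityZ3.Theorems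

namespace FiveUpSet

open Finset

/-! ### The configuration in the single cube `Finset (Fin 6)` -/

/-- The family of subsets of `Fin 6` encoded by a bit mask. [this work] -/
def maskSet6 (m : ℕ) : Finset (Finset (Fin 6)) := univ.filter fun s => Nat.testBit m (∑ j ∈ s, 2 ^ (j : ℕ))

/-- `X`: the cylinder over `P = 0xffec` along the coordinates `0,1`. [this work] -/
def cgX : Finset (Finset (Fin 6)) := maskSet6 18446744073708568320

/-- `Y`: the product-cube up-set of the family `cexF` (mask `0xf8f8e0e088880000`). [this work] -/
def cgY : Finset (Finset (Fin 6)) := maskSet6 17940336370598281216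

/-- The translate `t = {0,1}` (all index coordinates). [this work] -/
def cgT : Finset (Fin 6) := {0, 1}

/-- Level code of a set: its trace on the index coordinates `0,1`. [this work] -/
def lev6 (d : Finset (Fin 6)) : ℕ := ∑ j ∈ d.filter (fun j : Fin 6 => j.val < 2), 2 ^ j.val

/-- Point code of a set: its trace on the fibre coordinates `2,…,5`, shifted down by `2`. [this work] -/
def pt6 (d : Finset (Fin 6)) : ℕ := ∑ j ∈ d.filter (fun j : Fin 6 => 2 ≤ j.val), 2 ^ (j.val - 2)

/-- The coefficient table of `…TriWTiltCertFalse` (`ycoef`), keyed by (tag, level code, point code, power). [this work] -/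
def ycoef6 (tag : ℕ) (k : ℕ) (d : Finset (Fin 6)) : ℚ :=
  match tag, lev6 d, pt6 d, k with
  | 1, 0, 2, 3 => (1 : ℚ)
  | 1, 0, 3, 3 => (-2 : ℚ)
  | 1, 0, 3, 4 => (2 : ℚ)
  | 1, 0, 6, 4 => (1 : ℚ)
  | 1, 0, 6, 5 => (-2 : ℚ)
  | 1, 0, 10, 3 => (-1 : ℚ)
  | 1, 0, 10, 4 => (1 : ℚ)
  | 1, 0, 11, 3 => (2 : ℚ)
  | 1, 0, 11, 4 => (-4 : ℚ)
  | 1, 0, 11, 5 => (2 : ℚ)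
  | 2, 0, 2, 0 => (1 : ℚ)
  | 2, 0, 6, 0 => (-1 : ℚ)
  | 2, 0, 10, 0 => (1 : ℚ)
  | 2, 0, 10, 1 => (-1 : ℚ)
  | 1, 1, 2, 4 => (1 : ℚ)
  | 1, 1, 2, 5 => (-2 : ℚ)
  | 1, 1, 6, 4 => (-1 : ℚ)
  | 1, 1, 6, 5 => (2 : ℚ)
  | 2, 1, 2, 0 => (-1 : ℚ)
  | 2, 1, 6, 1 => (1 : ℚ)
  | 1, 2, 2, 4 => (1 : ℚ)
  | 1, 2, 2, 5 => (-2 : ℚ)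
  | 1, 2, 6, 4 => (-1 : ℚ)
  | 1, 2, 6, 5 => (2 : ℚ)
  | 2, 2, 2, 0 => (-1 : ℚ)
  | 2, 2, 6, 1 => (1 : ℚ)
  | 0, 3, 6, 3 => (-1 : ℚ)
  | 0, 3, 7, 3 => (1 : ℚ)
  | 0, 3, 7, 4 => (-1 : ℚ)
  | 1, 3, 2, 4 => (-1 : ℚ)
  | 1, 3, 2, 5 => (2 : ℚ)
  | 2, 3, 2, 1 => (1 : ℚ)
  | _, _, _, _ => 0

/-- The `D₁`-part `a(q)` of the kernel vector. [this work] -/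
def cgA (q : ℚ) (d : Finset (Fin 6)) : ℚ := ∑ k ∈ range 6, ycoef6 0 k d * q ^ k
/-- The `D₂`-part `b(q)` of the kernel vector. [this work] -/
def cgB (q : ℚ) (d : Finset (Fin 6)) : ℚ := ∑ k ∈ range 6, ycoef6 1 k d * q ^ k
/-- The `D₃`-part `c(q)` of the kernel vector. [this work] -/
def cgC (q : ℚ) (d : Finset (Fin 6)) : ℚ := ∑ k ∈ range 6, ycoef6 2 k d * q ^ k

/-! ### Monomial structure of the entries -/

/-- `[d ⊆ u]` as the `q^0`-monomial: `zc e d u = [e = 0][d ⊆ u]`. [this work] -/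
def zc (e : ℕ) (d u : Finset (Fin 6)) : ℚ := if e = 0 ∧ d ⊆ u then 1 else 0

/-- `qzeta q d u` is the monomial `q^{#(u \ d)}` (or `0`): `qc e d u = [d ⊆ u][#(u \ d) = e]`. [this work] -/
def qc (e : ℕ) (d u : Finset (Fin 6)) : ℚ := if d ⊆ u ∧ (u \ d).card = e then 1 else 0

/-- `[d ⊆ u] = Σ_{e<7} zc e d u · q^e`. [this work] -/
theorem zeta_eq_sum_zc (q : ℚ) (d u : Finset (Fin 6)) :
    (if d ⊆ u then (1 : ℚ) else 0) = ∑ e ∈ range 7, zc e d u * q ^ e := by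
  rw [Finset.sum_eq_single 0]
  · simp [zc]
  · intro e _ he
    simp [zc, he]
  · intro h
    exact absurd (by simp) h

/-- `qzeta q d u = Σ_{e<7} qc e d u · q^e` (the distance is at most `6`). [this work] -/
theorem qzeta_eq_sum_qc (q : ℚ) (d u : Finset (Fin 6)) :
    qzeta q d u = ∑ e ∈ range 7, qc e d u * q ^ e := by
  have hlt : (u \ d).card < 7 := by
    calc (u \ d).card ≤ (univ : Finset (Fin 6)).card := card_le_card (subset_univ _)
      _ = 6 := by simp
      _ < 7 := by norm_num
  unfold qzeta qc
  by_cases hs : d ⊆ u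
  · rw [if_pos hs, Finset.sum_eq_single (u \ d).card]
    · simp [hs]
    · intro e _ he
      rw [if_neg (fun h => he h.2.symm), zero_mul]
    · intro h
      exact absurd (mem_range.2 hlt) h
  · rw [if_neg hs]
    symm
    refine Finset.sum_eq_zero fun e _ => ?_
    rw [if_neg (fun h => hs h.1), zero_mul]

/-- Two polynomial-times-monomial sums vanish identically once all the `q^j`-coefficient identities hold (the bookkeeping behind the three equation families). [this work] -/
theorem pair_sum_eq_zero (q : ℚ) (S : Finset (Finset (Fin 6))) (f g Zf Zg : ℕ → Finset (Fin 6) → ℚ)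
    (hid : ∀ j ∈ range 12, ∑ p ∈ (range 6 ×ˢ range 7).filter (fun p => p.1 + p.2 = j), ∑ d ∈ S, (f p.1 d * Zf p.2 d + g p.1 d * Zg p.2 d) = 0) :
    ∑ d ∈ S, ((∑ k ∈ range 6, f k d * q ^ k) * (∑ e ∈ range 7, Zf e d * q ^ e)
      + (∑ k ∈ range 6, g k d * q ^ k) * (∑ e ∈ range 7, Zg e d * q ^ e)) = 0 := by
  have step1 : ∑ d ∈ S, ((∑ k ∈ range 6, f k d * q ^ k) * (∑ e ∈ range 7, Zf e d * q ^ e)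
      + (∑ k ∈ range 6, g k d * q ^ k) * (∑ e ∈ range 7, Zg e d * q ^ e))
      = ∑ d ∈ S, ∑ p ∈ range 6 ×ˢ range 7, (f p.1 d * Zf p.2 d + g p.1 d * Zg p.2 d) * q ^ (p.1 + p.2) := by
    refine sum_congr rfl fun d _ => ?_
    rw [Finset.sum_mul_sum, Finset.sum_mul_sum, Finset.sum_product, ← Finset.sum_add_distrib]
    refine sum_congr rfl fun k _ => ?_
    rw [← Finset.sum_add_distrib]
    refine sum_congr rfl fun e _ => ?_
    rw [pow_add]; ring
  have step2 : ∑ d ∈ S, ∑ p ∈ range 6 ×ˢ range 7, (f p.1 d * Zf p.2 d + g p.1 d * Zg p.2 d) * q ^ (p.1 + p.2)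
      = ∑ p ∈ range 6 ×ˢ range 7, (∑ d ∈ S, (f p.1 d * Zf p.2 d + g p.1 d * Zg p.2 d)) * q ^ (p.1 + p.2) := by
    rw [Finset.sum_comm]
    refine sum_congr rfl fun p _ => ?_
    rw [Finset.sum_mul]
  have hmaps : ∀ p ∈ range 6 ×ˢ range 7, (fun p : ℕ × ℕ => p.1 + p.2) p ∈ range 12 := by
    intro p hp
    rw [mem_product, mem_range, mem_range] at hp
    show p.1 + p.2 ∈ range 12
    rw [mem_range]
    omega
  have step3 : ∑ p ∈ range 6 ×ˢ range 7, (∑ d ∈ S, (f p.1 d * Zf p.2 d + g p.1 d * Zg p.2 d)) * q ^ (p.1 + p.2)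
      = ∑ j ∈ range 12, ∑ p ∈ (range 6 ×ˢ range 7).filter (fun p => p.1 + p.2 = j),
          (∑ d ∈ S, (f p.1 d * Zf p.2 d + g p.1 d * Zg p.2 d)) * q ^ (p.1 + p.2) :=
    (Finset.sum_fiberwise_of_maps_to hmaps _).symm
  rw [step1, step2, step3]
  refine Finset.sum_eq_zero fun j hj => ?_
  have inner : ∑ p ∈ (range 6 ×ˢ range 7).filter (fun p => p.1 + p.2 = j),
        (∑ d ∈ S, (f p.1 d * Zf p.2 d + g p.1 d * Zg p.2 d)) * q ^ (p.1 + p.2)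
      = (∑ p ∈ (range 6 ×ˢ range 7).filter (fun p => p.1 + p.2 = j),
          ∑ d ∈ S, (f p.1 d * Zf p.2 d + g p.1 d * Zg p.2 d)) * q ^ j := by
    rw [Finset.sum_mul]
    refine sum_congr rfl fun p hp => ?_
    rw [(mem_filter.1 hp).2]
  rw [inner, hid j hj, zero_mul]

/-! ### Decided facts -/

/-- Plumbing for `decide`: an up-set check over the finite powerset of `Fin 6`. [folklore] -/
private theorem isUpperSet_of_forall6 {A : Finset (Finset (Fin 6))}
    (h : ∀ a ∈ (univ : Finset (Finset (Fin 6))), ∀ b ∈ (univ : Finset (Finset (Fin 6))), a ⊆ b → a ∈ A → b ∈ A) :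
    IsUpperSet (A : Set (Finset (Fin 6))) := fun a b hab ha =>
  mem_coe.2 (h a (mem_univ a) b (mem_univ b) hab (mem_coe.1 ha))

set_option maxRecDepth 1000000 in
/-- `cgX` is an up-set. [this work] -/
theorem isUpperSet_cgX : IsUpperSet (cgX : Set (Finset (Fin 6))) := isUpperSet_of_forall6 (by decide)

set_option maxRecDepth 1000000 in
/-- `cgY` is an up-set. [this work] -/
theorem isUpperSet_cgY : IsUpperSet (cgY : Set (Finset (Fin 6))) := isUpperSet_of_forall6 (by decide)

/-- Support of `a`: off `refl X ∩ Y` every coefficient vanishes. [this work] -/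
theorem ycoef6_a_support : ∀ d ∈ (univ : Finset (Finset (Fin 6))), d ∉ refl cgX ∩ cgY → ∀ k ∈ range 6, ycoef6 0 k d = 0 := by decide
/-- Support of `b`: off `X ∩ refl Y` every coefficient vanishes. [this work] -/
theorem ycoef6_b_support : ∀ d ∈ (univ : Finset (Finset (Fin 6))), d ∉ cgX ∩ refl cgY → ∀ k ∈ range 6, ycoef6 1 k d = 0 := by decide
/-- Support of `c`: off `refl (X ∩ Y)` every coefficient vanishes. [this work] -/
theorem ycoef6_c_support : ∀ d ∈ (univ : Finset (Finset (Fin 6))), d ∉ refl (cgX ∩ cgY) → ∀ k ∈ range 6, ycoef6 2 k d = 0 := by decide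

/-- Coefficient identities of equation family (A): columns `u ∈ X ∩ Y`, `Σ_d a_d [d ⊆ u] + Σ_d c_d ζ_q(d,u)`. [this work] -/
theorem cg_identity_A : ∀ u ∈ cgX ∩ cgY, ∀ j ∈ range 12,
    ∑ p ∈ (range 6 ×ˢ range 7).filter (fun p => p.1 + p.2 = j), ∑ d ∈ (univ : Finset (Finset (Fin 6))),
      (ycoef6 0 p.1 d * zc p.2 d u + ycoef6 2 p.1 d * qc p.2 d u) = 0 := by
  native_decide

/-- Coefficient identities of equation family (B): columns `u ∈ X ∩ Y`, `Σ_d a_d ζ_q(d,u) + Σ_d b_d [d ⊆ u]`. [this work] -/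
theorem cg_identity_B : ∀ u ∈ cgX ∩ cgY, ∀ j ∈ range 12,
    ∑ p ∈ (range 6 ×ˢ range 7).filter (fun p => p.1 + p.2 = j), ∑ d ∈ (univ : Finset (Finset (Fin 6))),
      (ycoef6 0 p.1 d * qc p.2 d u + ycoef6 1 p.1 d * zc p.2 d u) = 0 := by
  native_decide

/-- Coefficient identities of equation family (E): columns `u ∈ refl X ∩ transl t Y`, `Σ_d c_d [d ⊆ u]` (written with a zero second summand). [this work] -/
theorem cg_identity_E : ∀ u ∈ refl cgX ∩ transl cgT cgY, ∀ j ∈ range 12,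
    ∑ p ∈ (range 6 ×ˢ range 7).filter (fun p => p.1 + p.2 = j), ∑ d ∈ (univ : Finset (Finset (Fin 6))),
      (ycoef6 2 p.1 d * zc p.2 d u + ycoef6 2 p.1 d * 0) = 0 := by
  native_decide

/-- The witness value: `c(q)` is the constant `1` at `d = {3}`. [this work] -/
theorem cgC_three (q : ℚ) : cgC q {3} = 1 := by
  have h0 : ycoef6 2 0 ({3} : Finset (Fin 6)) = 1 := by decide
  have h1 : ycoef6 2 1 ({3} : Finset (Fin 6)) = 0 := by decide
  have h2 : ycoef6 2 2 ({3} : Finset (Fin 6)) = 0 := by decide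
  have h3 : ycoef6 2 3 ({3} : Finset (Fin 6)) = 0 := by decide
  have h4 : ycoef6 2 4 ({3} : Finset (Fin 6)) = 0 := by decide
  have h5 : ycoef6 2 5 ({3} : Finset (Fin 6)) = 0 := by decide
  simp [cgC, Finset.sum_range_succ, h0, h1, h2, h3, h4, h5]

/-! ### The refutation -/

/-- A coefficient sum with all coefficients zero vanishes. [this work] -/
private theorem poly_eq_zero_of_coef {tag : ℕ} {d : Finset (Fin 6)} (h : ∀ k ∈ range 6, ycoef6 tag k d = 0) (q : ℚ) :
    ∑ k ∈ range 6, ycoef6 tag k d * q ^ k = 0 :=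
  Finset.sum_eq_zero fun k hk => by rw [h k hk, zero_mul]

/-- **`CertGenKernel` is false.**  For `X = cgX`, `Y = cgY`, `t = {0,1}` in the cube `Finset (Fin 6)` and EVERY `q : ℚ`, the explicit vectors `cgA q, cgB q, cgC q` satisfy the
support conditions and the three equation families of `CertGenKernelAt X Y t q`, and `cgC q {3} = 1 ≠ 0`. [this work] -/
theorem not_certGenKernel : ¬ CertGenKernel := by
  intro h
  obtain ⟨q, hq⟩ := h (Fin 6) cgX cgY cgT isUpperSet_cgX isUpperSet_cgY
  have ha : ∀ d, cgA q d ≠ 0 → d ∈ refl cgX ∩ cgY := by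
    intro d hd
    by_contra hnot
    exact hd (poly_eq_zero_of_coef (ycoef6_a_support d (mem_univ d) hnot) q)
  have hb : ∀ d, cgB q d ≠ 0 → d ∈ cgX ∩ refl cgY := by
    intro d hd
    by_contra hnot
    exact hd (poly_eq_zero_of_coef (ycoef6_b_support d (mem_univ d) hnot) q)
  have hc : ∀ d, cgC q d ≠ 0 → d ∈ refl (cgX ∩ cgY) := by
    intro d hd
    by_contra hnot
    exact hd (poly_eq_zero_of_coef (ycoef6_c_support d (mem_univ d) hnot) q)
  have hA : ∀ u, u ∈ cgX ∩ cgY →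
      ∑ d, cgA q d * (if d ⊆ u then (1 : ℚ) else 0) + ∑ d, cgC q d * qzeta q d u = 0 := by
    intro u hu
    rw [← Finset.sum_add_distrib]
    have e1 : ∀ d : Finset (Fin 6), cgA q d * (if d ⊆ u then (1 : ℚ) else 0) + cgC q d * qzeta q d u
        = (∑ k ∈ range 6, ycoef6 0 k d * q ^ k) * (∑ e ∈ range 7, zc e d u * q ^ e)
          + (∑ k ∈ range 6, ycoef6 2 k d * q ^ k) * (∑ e ∈ range 7, qc e d u * q ^ e) := by
      intro d
      rw [cgA, cgC, zeta_eq_sum_zc q d u, qzeta_eq_sum_qc q d u]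
    simp_rw [e1]
    exact pair_sum_eq_zero q univ (ycoef6 0) (ycoef6 2) (fun e d => zc e d u) (fun e d => qc e d u) (cg_identity_A u hu)
  have hB : ∀ u, u ∈ cgX ∩ cgY →
      ∑ d, cgA q d * qzeta q d u + ∑ d, cgB q d * (if d ⊆ u then (1 : ℚ) else 0) = 0 := by
    intro u hu
    rw [← Finset.sum_add_distrib]
    have e1 : ∀ d : Finset (Fin 6), cgA q d * qzeta q d u + cgB q d * (if d ⊆ u then (1 : ℚ) else 0)
        = (∑ k ∈ range 6, ycoef6 0 k d * q ^ k) * (∑ e ∈ range 7, qc e d u * q ^ e)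
          + (∑ k ∈ range 6, ycoef6 1 k d * q ^ k) * (∑ e ∈ range 7, zc e d u * q ^ e) := by
      intro d
      rw [cgA, cgB, zeta_eq_sum_zc q d u, qzeta_eq_sum_qc q d u]
    simp_rw [e1]
    exact pair_sum_eq_zero q univ (ycoef6 0) (ycoef6 1) (fun e d => qc e d u) (fun e d => zc e d u) (cg_identity_B u hu)
  have hE : ∀ u, u ∈ refl cgX ∩ transl cgT cgY → ∑ d, cgC q d * (if d ⊆ u then (1 : ℚ) else 0) = 0 := by
    intro u hu
    have e1 : ∀ d : Finset (Fin 6), cgC q d * (if d ⊆ u then (1 : ℚ) else 0)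
        = (∑ k ∈ range 6, ycoef6 2 k d * q ^ k) * (∑ e ∈ range 7, zc e d u * q ^ e)
          + (∑ k ∈ range 6, ycoef6 2 k d * q ^ k) * (∑ e ∈ range 7, (0 : ℚ) * q ^ e) := by
      intro d
      rw [cgC, zeta_eq_sum_zc q d u]
      simp
    simp_rw [e1]
    exact pair_sum_eq_zero q univ (ycoef6 2) (ycoef6 2) (fun e d => zc e d u) (fun _ _ => 0) (cg_identity_E u hu)
  obtain ⟨-, -, hc0⟩ := hq (cgA q) (cgB q) (cgC q) ha hb hc hA hB hE
  have h1 : cgC q {3} = 1 := cgC_three q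
  rw [hc0 {3}] at h1
  exact zero_ne_one h1

end FiveUpSet

end Summit.CriticalPhenomena.PercolationContinuityZ3.Theorems
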